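import Mathlib
import Summits.Ventures.PercRepro2.GradedClosure
import Summits.Ventures.PercRepro2.LevelHarrisClosure
import Summits.Ventures.PercRepro2.V1SP

/-!
# The level-2 graded Hall forms G_2 and V2_2 hold on every series–parallel network
(seat mine-b, cell pub-perc-repro2; conjectures/MINE-B.md §20.13–20.16)

`G_2` is the Hall form of the row (U) read at blue level 2: every lower set `D` has
`#(D ∩ {r = 1, b ≥ 1}) ≥ Σ_{D ∩ {r = 0, b ≥ 2}} b` — by Hall, every configuration with `F_R = 0`,
`F_B = a ≥ 2` owns `a` private configurations below it with `F_R = 1` AND `F_B ≥ 1`; `V2_2` is the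
down-form of (V2).  GradedClosure.lean gives the series closures (`gDom_ser`, `vDom_ser`) and the parallel
closure of `G_2` given the levels `≤ 2` (`gDom_par_le` below, the `j ≤ k` form of `gDom_par`); here the
parallel closure of `V2_2` is proved from `V2_2` and the level-1 Harris inequality on the parts
(`vDom_par2`: pointwise `v_2(x∗y) ≥ [r_y = 0]·v_2(x) + [b_y = 1]·h_1(x) + (x ↔ y)`), the atoms are
checked, and the induction over `SP` (with `DownDom` and `LevelHarris` carried along, V1SP.lean) gives

  `SP.gDom2 : ∀ s : SP, GDom 2 s.rLab s.bLab`  and  `SP.vDom2 : ∀ s : SP, VDom 2 s.rLab s.bLab`.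
-/

namespace Summit.Ventures.PercRepro2.UHClosure

open Finset

variable {X Y : Type*}

/-- the level-1 Harris weight `[a ≥ 1] − [c ≥ 1]` -/
def hw1 (a c : ℕ) : ℤ := (if 1 ≤ a then 1 else 0) - (if 1 ≤ c then 1 else 0)

/-- the parallel certificate for `V2_2`: a fibre at red level 0 charges `v_2`, a fibre at blue level 1 the
level-1 Harris weight -/
def psiV2 (ρ β a c : ℕ) : ℤ := (if ρ = 0 then vw 2 a c else 0) + (if β = 1 then hw1 a c else 0)

/-- the parallel certificate, red level 0 on both sides -/
lemma pvp_00 (c β : ℕ) : psiV2 0 β 0 c + psiV2 0 c 0 β ≤ vw 2 (0 + 0) (c + β) := by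
  unfold psiV2 hw1; simp only [vw_zero, if_true, zero_add]
  split_ifs <;> push_cast <;> omega

/-- the parallel certificate, red levels 0 and ≥ 1 -/
lemma pvp_0p (c ρ β : ℕ) (hρ : 1 ≤ ρ) : psiV2 ρ β 0 c + psiV2 0 c ρ β ≤ vw 2 (0 + ρ) (c + β) := by
  unfold psiV2 hw1; simp only [vw_zero, vw_pos _ _ _ hρ, show ¬ ρ = 0 by omega, if_false, if_true, zero_add]
  split_ifs <;> push_cast <;> omega

/-- the parallel certificate, red levels ≥ 1 on both sides -/
lemma pvp_pp (a c ρ β : ℕ) (ha : 1 ≤ a) (hρ : 1 ≤ ρ) : psiV2 ρ β a c + psiV2 a c ρ β ≤ vw 2 (a + ρ) (c + β) := by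
  unfold psiV2 hw1; simp only [vw_pos _ _ _ hρ, vw_pos _ _ _ ha, show ¬ ρ = 0 by omega, show ¬ a = 0 by omega, if_false, zero_add]
  have : vw 2 (a + ρ) (c + β) = if c + β = 1 then 1 else 0 := vw_pos _ _ _ (by omega)
  rw [this]; split_ifs <;> omega

/-- the charges commute -/
lemma psiV2_comm (ρ β a c : ℕ) : psiV2 ρ β a c + psiV2 a c ρ β = psiV2 a c ρ β + psiV2 ρ β a c := add_comm _ _

/-- **The pointwise certificate for the parallel closure of `V2_2`.** -/
theorem pointwiseVpar2 (a c ρ β : ℕ) : psiV2 ρ β a c + psiV2 a c ρ β ≤ vw 2 (a + ρ) (c + β) := by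
  rcases Nat.eq_zero_or_pos a with ha | ha <;> rcases Nat.eq_zero_or_pos ρ with hρ | hρ
  · subst ha; subst hρ; exact pvp_00 c β
  · subst ha; exact pvp_0p c ρ β hρ
  · subst hρ; rw [psiV2_comm, Nat.add_comm a 0, Nat.add_comm c β]; exact pvp_0p β a c ha
  · exact pvp_pp a c ρ β ha hρ

/-- `gw 1` and `gw 0` are the weight `ν` of (UH) -/
lemma gw_le_one_eq_nu (j : ℕ) (hj : j ≤ 1) (r b : X → ℕ) (x : X) : gw j (r x) (b x) = nu r b x := by
  unfold gw nu
  interval_cases j <;> split_ifs <;> omega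

/-- `DownDom` gives `G_j` for `j ≤ 1` -/
theorem gDom_of_downDom [Preorder X] (j : ℕ) (hj : j ≤ 1) (r b : X → ℕ) (h : DownDom r b) : GDom j r b := by
  intro D hD
  have := h D hD
  rw [show ∑ x ∈ D, gw j (r x) (b x) = ∑ x ∈ D, nu r b x from
    Finset.sum_congr rfl (fun x _ => gw_le_one_eq_nu j hj r b x)]
  exact this

section fibres

variable [Preorder X] [Preorder Y] [Fintype X] [Fintype Y] [DecidableEq X] [DecidableEq Y]

omit [Fintype Y] in
/-- the level-1 Harris weight has non-negative mass on the fibre over `y` -/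
theorem fibre_hw1_fst (r b : X → ℕ) (hX : LevelHarris r b) (D : Finset (X × Y))
    (hD : IsLowerSet (↑D : Set (X × Y))) (y : Y) : 0 ≤ ∑ x, ind D x y * hw1 (r x) (b x) := by
  have h := fibre_fst_level r b hX D hD y 1
  have e : ∑ x, ind D x y * hw1 (r x) (b x) = ∑ x, ind D x y * indGe 1 r x - ∑ x, ind D x y * indGe 1 b x := by
    rw [← Finset.sum_sub_distrib]; apply Finset.sum_congr rfl; intro x _; unfold hw1 indGe; ring
  rw [e]; linarith

omit [Fintype X] in
/-- the level-1 Harris weight has non-negative mass on the fibre over `x` -/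
theorem fibre_hw1_snd (r' b' : Y → ℕ) (hY : LevelHarris r' b') (D : Finset (X × Y))
    (hD : IsLowerSet (↑D : Set (X × Y))) (x : X) : 0 ≤ ∑ y, ind D x y * hw1 (r' y) (b' y) := by
  have h := fibre_snd_level r' b' hY D hD x 1
  have e : ∑ y, ind D x y * hw1 (r' y) (b' y) = ∑ y, ind D x y * indGe 1 r' y - ∑ y, ind D x y * indGe 1 b' y := by
    rw [← Finset.sum_sub_distrib]; apply Finset.sum_congr rfl; intro y _; unfold hw1 indGe; ring
  rw [e]; linarith

omit [Fintype Y] in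
/-- the `V2_2` parallel charge of the fibre over `y` is non-negative -/
theorem fibre_psiV2_fst (r b : X → ℕ) (hV : VDom 2 r b) (hH : LevelHarris r b) (D : Finset (X × Y))
    (hD : IsLowerSet (↑D : Set (X × Y))) (ρ β : ℕ) (y : Y) :
    0 ≤ ∑ x, ind D x y * psiV2 ρ β (r x) (b x) := by
  have e : ∑ x, ind D x y * psiV2 ρ β (r x) (b x)
      = (if ρ = 0 then ∑ x, ind D x y * vw 2 (r x) (b x) else 0) + (if β = 1 then ∑ x, ind D x y * hw1 (r x) (b x) else 0) := by
    unfold psiV2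
    split_ifs <;> simp [Finset.sum_add_distrib, mul_add]
  rw [e]
  apply add_nonneg
  · split_ifs
    · exact fibre_fst_of_lower _ hV D hD y
    · exact le_rfl
  · split_ifs
    · exact fibre_hw1_fst r b hH D hD y
    · exact le_rfl

omit [Fintype X] in
/-- the `V2_2` parallel charge of the fibre over `x` is non-negative -/
theorem fibre_psiV2_snd (r' b' : Y → ℕ) (hV : VDom 2 r' b') (hH : LevelHarris r' b') (D : Finset (X × Y))
    (hD : IsLowerSet (↑D : Set (X × Y))) (ρ β : ℕ) (x : X) :
    0 ≤ ∑ y, ind D x y * psiV2 ρ β (r' y) (b' y) := by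
  have e : ∑ y, ind D x y * psiV2 ρ β (r' y) (b' y)
      = (if ρ = 0 then ∑ y, ind D x y * vw 2 (r' y) (b' y) else 0) + (if β = 1 then ∑ y, ind D x y * hw1 (r' y) (b' y) else 0) := by
    unfold psiV2
    split_ifs <;> simp [Finset.sum_add_distrib, mul_add]
  rw [e]
  apply add_nonneg
  · split_ifs
    · exact fibre_snd_of_lower _ hV D hD x
    · exact le_rfl
  · split_ifs
    · exact fibre_hw1_snd r' b' hH D hD x
    · exact le_rfl

/-- **`V2_2` is closed under parallel composition given `V2_2` and the level-1 Harris inequality.** -/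
theorem vDom_par2 (r b : X → ℕ) (r' b' : Y → ℕ) (hV : VDom 2 r b) (hH : LevelHarris r b)
    (hV' : VDom 2 r' b') (hH' : LevelHarris r' b') :
    VDom 2 (fun p : X × Y => r p.1 + r' p.2) (fun p : X × Y => b p.1 + b' p.2) := by
  intro D hD
  have key : ∀ p ∈ D, psiV2 (r' p.2) (b' p.2) (r p.1) (b p.1) + psiV2 (r p.1) (b p.1) (r' p.2) (b' p.2)
      ≤ vw 2 (r p.1 + r' p.2) (b p.1 + b' p.2) := by
    intro p _; obtain ⟨x, y⟩ := p; exact pointwiseVpar2 _ _ _ _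
  have hsum := Finset.sum_le_sum key
  rw [Finset.sum_add_distrib] at hsum
  have h1 : 0 ≤ ∑ p ∈ D, psiV2 (r' p.2) (b' p.2) (r p.1) (b p.1) := by
    rw [sum_D_eq' D (fun x y => psiV2 (r' y) (b' y) (r x) (b x)), Finset.sum_comm]
    exact Finset.sum_nonneg (fun y _ => fibre_psiV2_fst r b hV hH D hD (r' y) (b' y) y)
  have h2 : 0 ≤ ∑ p ∈ D, psiV2 (r p.1) (b p.1) (r' p.2) (b' p.2) := by
    rw [sum_D_eq' D (fun x y => psiV2 (r x) (b x) (r' y) (b' y))]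
    exact Finset.sum_nonneg (fun x _ => fibre_psiV2_snd r' b' hV' hH' D hD (r x) (b x) x)
  linarith

omit [Fintype Y] in
/-- the parallel `G` charge of the fibre over `y`, from the levels `≤ k` -/
theorem fibre_psiG_fst_le (k : ℕ) (r b : X → ℕ) (hG : ∀ j, j ≤ k → GDom j r b)
    (D : Finset (X × Y)) (hD : IsLowerSet (↑D : Set (X × Y))) (ρ β : ℕ) (y : Y) :
    0 ≤ ∑ x, ind D x y * psiG k ρ β (r x) (b x) := by
  unfold psiG
  split_ifs
  · exact fibre_fst_of_lower _ (hG (k - β) (Nat.sub_le k β)) D hD y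
  · simp

omit [Fintype X] in
/-- the parallel `G` charge of the fibre over `x`, from the levels `≤ k` -/
theorem fibre_psiG_snd_le (k : ℕ) (r' b' : Y → ℕ) (hG : ∀ j, j ≤ k → GDom j r' b')
    (D : Finset (X × Y)) (hD : IsLowerSet (↑D : Set (X × Y))) (ρ β : ℕ) (x : X) :
    0 ≤ ∑ y, ind D x y * psiG k ρ β (r' y) (b' y) := by
  unfold psiG
  split_ifs
  · exact fibre_snd_of_lower _ (hG (k - β) (Nat.sub_le k β)) D hD x
  · simp

/-- **`G_k` is closed under parallel composition, given the levels `G_j`, `j ≤ k`, on the parts.** -/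
theorem gDom_par_le (k : ℕ) (r b : X → ℕ) (r' b' : Y → ℕ) (hG : ∀ j, j ≤ k → GDom j r b)
    (hG' : ∀ j, j ≤ k → GDom j r' b') :
    GDom k (fun p : X × Y => r p.1 + r' p.2) (fun p : X × Y => b p.1 + b' p.2) := by
  intro D hD
  have key : ∀ p ∈ D, psiG k (r' p.2) (b' p.2) (r p.1) (b p.1) + psiG k (r p.1) (b p.1) (r' p.2) (b' p.2)
      ≤ gw k (r p.1 + r' p.2) (b p.1 + b' p.2) := by
    intro p _; obtain ⟨x, y⟩ := p; rw [gw_par_eq]; exact pointwiseGpar k _ _ _ _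
  have hsum := Finset.sum_le_sum key
  rw [Finset.sum_add_distrib] at hsum
  have h1 : 0 ≤ ∑ p ∈ D, psiG k (r' p.2) (b' p.2) (r p.1) (b p.1) := by
    rw [sum_D_eq' D (fun x y => psiG k (r' y) (b' y) (r x) (b x)), Finset.sum_comm]
    exact Finset.sum_nonneg (fun y _ => fibre_psiG_fst_le k r b hG D hD (r' y) (b' y) y)
  have h2 : 0 ≤ ∑ p ∈ D, psiG k (r p.1) (b p.1) (r' p.2) (b' p.2) := by
    rw [sum_D_eq' D (fun x y => psiG k (r x) (b x) (r' y) (b' y))]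
    exact Finset.sum_nonneg (fun x _ => fibre_psiG_snd_le k r' b' hG' D hD (r x) (b x) x)
  linarith

end fibres

end Summit.Ventures.PercRepro2.UHClosure

namespace Summit.Ventures.PercRepro2.V2Closure

open Finset
open Summit.Ventures.PercRepro2.UHClosure

/-- on a free edge every weight of `G_2` vanishes (no blue level ≥ 2) -/
theorem free_gDom2 : GDom 2 SP.free.rLab SP.free.bLab := by
  intro V _
  apply Finset.sum_nonneg; intro c _
  cases c <;> simp [gw, SP.rLab, SP.bLab]
/-- on a free edge every weight of `V2_2` vanishes -/
theorem free_vDom2 : VDom 2 SP.free.rLab SP.free.bLab := by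
  intro V _
  apply Finset.sum_nonneg; intro c _
  cases c <;> simp [vw, SP.rLab, SP.bLab]
/-- on a pinned edge the single state has `G_2`-weight 1 -/
theorem pin_gDom2 : GDom 2 SP.pin.rLab SP.pin.bLab := by
  intro V _
  apply Finset.sum_nonneg; intro c _
  simp [gw, SP.rLab, SP.bLab]
/-- on a pinned edge the single state has `V2_2`-weight 1 -/
theorem pin_vDom2 : VDom 2 SP.pin.rLab SP.pin.bLab := by
  intro V _
  apply Finset.sum_nonneg; intro c _
  simp [vw, SP.rLab, SP.bLab]
/-- on an absent edge the weights vanish -/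
theorem absent_gDom2 : GDom 2 SP.absent.rLab SP.absent.bLab := by
  intro V _
  apply Finset.sum_nonneg; intro c _
  simp [gw, SP.rLab, SP.bLab]
/-- on an absent edge the weights vanish -/
theorem absent_vDom2 : VDom 2 SP.absent.rLab SP.absent.bLab := by
  intro V _
  apply Finset.sum_nonneg; intro c _
  simp [vw, SP.rLab, SP.bLab]

/-- the levels `≤ 2` of the `G` family from `DownDom` and `G_2` -/
theorem gDom_le_two {X : Type*} [Preorder X] (r b : X → ℕ) (h1 : DownDom r b) (h2 : GDom 2 r b) :
    ∀ j, j ≤ 2 → GDom j r b := by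
  intro j hj
  rcases Nat.lt_or_ge j 2 with h | h
  · exact gDom_of_downDom j (by omega) r b h1
  · have : j = 2 := by omega
    subst this; exact h2

/-- **(UH), the level Harris inequalities, `G_2` and `V2_2` hold on every series–parallel network**
(induction over the network with the closure theorems `downDom_ser` / `downDom_par`,
`levelHarris_ser` / `levelHarris_par`, `gDom_ser` / `gDom_par_le`, `vDom_ser` / `vDom_par2`). -/
theorem SP.graded2 : ∀ s : SP, DownDom s.rLab s.bLab ∧ LevelHarris s.rLab s.bLab ∧
    GDom 2 s.rLab s.bLab ∧ VDom 2 s.rLab s.bLab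
  | .free => ⟨free_downDom, free_levelHarris, free_gDom2, free_vDom2⟩
  | .pin => ⟨pin_downDom, pin_levelHarris, pin_gDom2, pin_vDom2⟩
  | .absent => ⟨absent_downDom, absent_levelHarris, absent_gDom2, absent_vDom2⟩
  | .ser s t =>
      have hs := SP.graded2 s
      have ht := SP.graded2 t
      ⟨downDom_ser s.rLab s.bLab t.rLab t.bLab hs.1 (capHarris_of_levelHarris _ _ hs.2.1) ht.1
          (capHarris_of_levelHarris _ _ ht.2.1),
       levelHarris_ser s.rLab s.bLab t.rLab t.bLab hs.2.1 ht.2.1,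
       gDom_ser 2 le_rfl s.rLab s.bLab t.rLab t.bLab hs.2.2.1 hs.2.2.2 ht.2.2.1 ht.2.2.2,
       vDom_ser 2 le_rfl s.rLab s.bLab t.rLab t.bLab hs.2.2.2 ht.2.2.2⟩
  | .par s t =>
      have hs := SP.graded2 s
      have ht := SP.graded2 t
      ⟨downDom_par s.rLab s.bLab t.rLab t.bLab hs.1 ht.1,
       levelHarris_par s.rLab s.bLab t.rLab t.bLab hs.2.1 ht.2.1,
       gDom_par_le 2 s.rLab s.bLab t.rLab t.bLab (gDom_le_two _ _ hs.1 hs.2.2.1) (gDom_le_two _ _ ht.1 ht.2.2.1),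
       vDom_par2 s.rLab s.bLab t.rLab t.bLab hs.2.2.2 hs.2.1 ht.2.2.2 ht.2.1⟩

/-- **`G_2` on every series–parallel network**: every lower set has `#{r = 1, b ≥ 1} ≥ Σ_{r = 0, b ≥ 2} b`. -/
theorem SP.gDom2 (s : SP) : GDom 2 s.rLab s.bLab := (SP.graded2 s).2.2.1

/-- **`V2_2` (the down-form of (V2)) on every series–parallel network.** -/
theorem SP.vDom2 (s : SP) : VDom 2 s.rLab s.bLab := (SP.graded2 s).2.2.2

/-- The count of `G_2` on a series–parallel network: `#{r = 1, b ≥ 1} ≥ Σ_{r = 0, b ≥ 2} b` (the row (U)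
read at blue level 2). -/
theorem SP.sum_gw2_nonneg (s : SP) : 0 ≤ ∑ c, gw 2 (s.rLab c) (s.bLab c) :=
  SP.gDom2 s univ (by simp [isLowerSet_univ])

end Summit.Ventures.PercRepro2.V2Closure
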